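import Mathlib.Data.ZMod.Basic
import Literature.AnabelianGeometry.SemiGraphs.BouquetCriteria
import Literature.AnabelianGeometry.SemiGraphs.GraphCoveringFibres

/-!
# The cyclic `ℤ/M`-covering of a semi-graph twisted along one edge ([SemiAnbd] proof of Prop. 2.6, p. 29)

Mochizuki, *Semi-graphs of anabelioids*, Publ. RIMS **42** (2006) 221–322, §2, proof of
Proposition 2.6, p. 29 [cite: MochizukiSemiAnbd2006, Prop. 2.6 p.29]: "by using the loop `L` of `ℍ`
constituted by `e_a`, `e_b`, we may construct a finite graph-covering of degree `M`, `𝔾′ → 𝔾`,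
which is trivial over `𝕂`, but connected over `L`."  The standard construction: `M` copies
("levels" `ℤ/M`) of `𝔾`, glued cyclically along ONE chosen branch `b₀` (of the edge `e_a`): the
branch `(b₀, i)` abuts to its vertex at level `i + 1`, every other branch `(b, i)` at level `i`.

* `cyclicCover G b₀ M` and the projection `cyclicCoverHom : cyclicCover G b₀ M ⟶ G`;
* it is a graph if `G` is (`cyclicCover_isGraph`), an excision (`cyclicCoverHom_isExcision`), hence a
  finite graph-covering of degree `M` when `G` is a graph (`cyclicCoverHom_isFiniteGraphCovering`);
* "trivial over `𝕂`": for a sub-semi-graph `𝕂` not containing the edge of `b₀`, the level sections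
  `levelSection 𝕂 i : 𝕂 ⟶ cyclicCover` (`i ∈ ℤ/M`) lie over the inclusion `𝕂 ↪ 𝔾`
  (`levelSection_comp`).

Deliberately NOT here: connectedness over a loop through `e_a` (sequel), and the induced finite
étale covering of a semi-graph of anabelioids (`GraphCoveringEtale.lean`).
-/

namespace Literature.AnabelianGeometry.SemiGraphs

namespace SemiGraph

open CategoryTheory

universe u

variable (G : SemiGraph.{u}) (b₀ : G.Branch) (M : ℕ)

open Classical in
/-- The level shift of a branch in the cyclic cover: the twisted branch `b₀` raises the level by `1`,
every other branch keeps it. [cite: MochizukiSemiAnbd2006, Prop. 2.6 p.29] -/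
noncomputable def levelShift (b : G.Branch) (i : ZMod M) : ZMod M := if b = b₀ then i + 1 else i

/-- The twisted branch raises the level. [cite: MochizukiSemiAnbd2006, Prop. 2.6 p.29] -/
@[simp] theorem levelShift_self (i : ZMod M) : G.levelShift b₀ M b₀ i = i + 1 := by
  simp [levelShift]

/-- Untwisted branches keep the level. [cite: MochizukiSemiAnbd2006, Prop. 2.6 p.29] -/
theorem levelShift_of_ne {b : G.Branch} (hb : b ≠ b₀) (i : ZMod M) : G.levelShift b₀ M b i = i := by
  simp [levelShift, hb]

/-- The level shift is injective in the level. [cite: MochizukiSemiAnbd2006, Prop. 2.6 p.29] -/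
theorem levelShift_injective (b : G.Branch) : Function.Injective (G.levelShift b₀ M b) := by
  classical
  intro i j h
  by_cases hb : b = b₀
  · subst hb
    simpa using h
  · rwa [G.levelShift_of_ne b₀ M hb, G.levelShift_of_ne b₀ M hb] at h

/-- The level shift is surjective in the level. [cite: MochizukiSemiAnbd2006, Prop. 2.6 p.29] -/
theorem levelShift_surjective (b : G.Branch) : Function.Surjective (G.levelShift b₀ M b) := by
  classical
  intro j
  by_cases hb : b = b₀
  · subst hb
    exact ⟨j - 1, by simp⟩
  · exact ⟨j, G.levelShift_of_ne b₀ M hb j⟩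

/-- The cyclic `ℤ/M`-covering of `G` twisted along the branch `b₀`: `M` levels of every vertex, edge
and branch; the branch `(b₀, i)` abuts at level `i + 1`, every other branch `(b, i)` at level `i`.
[cite: MochizukiSemiAnbd2006, Prop. 2.6 p.29] -/
noncomputable def cyclicCover : SemiGraph.{u} where
  Vertex := G.Vertex × ZMod M
  Edge := G.Edge × ZMod M
  Branch := G.Branch × ZMod M
  edgeOf b := (G.edgeOf b.1, b.2)
  abuts b := (G.abuts b.1).map fun v => (v, G.levelShift b₀ M b.1 b.2)
  two_branches e := by
    obtain ⟨b₁, b₂, hne, h₁, h₂, hall⟩ := G.two_branches e.1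
    refine ⟨(b₁, e.2), (b₂, e.2), fun h => hne (congrArg Prod.fst h), Prod.ext h₁ rfl,
      Prod.ext h₂ rfl, fun b hb => ?_⟩
    have hb1 : G.edgeOf b.1 = e.1 := congrArg Prod.fst hb
    have hb2 : b.2 = e.2 := congrArg Prod.snd hb
    rcases hall b.1 hb1 with h | h
    · exact Or.inl (Prod.ext h hb2)
    · exact Or.inr (Prod.ext h hb2)

/-- The coincidence maps of the cyclic cover. [cite: MochizukiSemiAnbd2006, Prop. 2.6 p.29] -/
theorem cyclicCover_abuts (b : G.Branch) (i : ZMod M) :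
    (G.cyclicCover b₀ M).abuts (b, i) = (G.abuts b).map fun v => (v, G.levelShift b₀ M b i) := rfl

/-- The edges of the cyclic cover. [cite: MochizukiSemiAnbd2006, Prop. 2.6 p.29] -/
theorem cyclicCover_edgeOf (b : G.Branch) (i : ZMod M) :
    (G.cyclicCover b₀ M).edgeOf (b, i) = (G.edgeOf b, i) := rfl

/-- The projection `cyclicCover G b₀ M ⟶ G` (forget the level). [cite: MochizukiSemiAnbd2006, Prop. 2.6 p.29] -/
noncomputable def cyclicCoverHom : G.cyclicCover b₀ M ⟶ G where
  vertexMap := Prod.fst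
  edgeMap := Prod.fst
  branchMap := Prod.fst
  edgeOf_branchMap _ := rfl
  branchMap_injOn b₁ b₂ he hb := by
    change (G.edgeOf b₁.1, b₁.2) = (G.edgeOf b₂.1, b₂.2) at he
    exact Prod.ext hb (Prod.mk.inj he).2
  abuts_branchMap b v h := by
    change (G.abuts b.1).map _ = some v at h
    obtain ⟨w, hw, hwv⟩ := Option.map_eq_some_iff.mp h
    rw [← hwv]
    exact hw

/-- The projection on vertices is the first projection. [cite: MochizukiSemiAnbd2006, Prop. 2.6 p.29] -/
@[simp] theorem cyclicCoverHom_vertexMap (x : (G.cyclicCover b₀ M).Vertex) :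
    (G.cyclicCoverHom b₀ M).vertexMap x = x.1 := rfl

/-- The projection on edges is the first projection. [cite: MochizukiSemiAnbd2006, Prop. 2.6 p.29] -/
@[simp] theorem cyclicCoverHom_edgeMap (x : (G.cyclicCover b₀ M).Edge) :
    (G.cyclicCoverHom b₀ M).edgeMap x = x.1 := rfl

/-- The projection on branches is the first projection. [cite: MochizukiSemiAnbd2006, Prop. 2.6 p.29] -/
@[simp] theorem cyclicCoverHom_branchMap (x : (G.cyclicCover b₀ M).Branch) :
    (G.cyclicCoverHom b₀ M).branchMap x = x.1 := rfl

/-- The cyclic cover of a graph is a graph. [cite: MochizukiSemiAnbd2006, Prop. 2.6 p.29] -/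
theorem cyclicCover_isGraph (hG : G.IsGraph) : (G.cyclicCover b₀ M).IsGraph := by
  refine ⟨fun b => ?_⟩
  obtain ⟨b, i⟩ := b
  rw [cyclicCover_abuts]
  obtain ⟨v, hv⟩ := Option.isSome_iff_exists.mp (hG.abuts_isSome b)
  rw [hv]
  rfl

/-- The projection is an excision: at a vertex `(v, i)` the branches are the `(b, j)` with `b`
abutting to `v` and `j` the level forced by `b`, so the star map is a bijection onto the star of `v`.
[cite: MochizukiSemiAnbd2006, Prop. 2.6 p.29] -/
theorem cyclicCoverHom_isExcision : IsExcision (G.cyclicCoverHom b₀ M) := by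
  intro x
  constructor
  · rintro ⟨⟨b, j⟩, hb⟩ ⟨⟨b', j'⟩, hb'⟩ h
    have h1 : b = b' := congrArg Subtype.val h
    subst h1
    have hbx : (G.cyclicCover b₀ M).abuts (b, j) = some x := hb
    have hbx' : (G.cyclicCover b₀ M).abuts (b, j') = some x := hb'
    rw [cyclicCover_abuts] at hbx hbx'
    obtain ⟨w, -, hw⟩ := Option.map_eq_some_iff.mp hbx
    obtain ⟨w', -, hw'⟩ := Option.map_eq_some_iff.mp hbx'
    have h2 : G.levelShift b₀ M b j = G.levelShift b₀ M b j' :=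
      (congrArg Prod.snd hw).trans (congrArg Prod.snd hw').symm
    have h3 : j = j' := G.levelShift_injective b₀ M b h2
    subst h3
    rfl
  · rintro ⟨b, hb⟩
    have hbx : G.abuts b = some x.1 := hb
    obtain ⟨j, hj⟩ := G.levelShift_surjective b₀ M b x.2
    refine ⟨⟨(b, j), ?_⟩, rfl⟩
    rw [cyclicCover_abuts, hbx, Option.map_some, hj]
    cases x
    rfl

/-- The fibre of the projection over a vertex is the set of levels `ℤ/M`.
[cite: MochizukiSemiAnbd2006, Prop. 2.6 p.29] -/
noncomputable def cyclicCoverVertexFiberEquiv (v : G.Vertex) :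
    (G.cyclicCoverHom b₀ M).VertexFiber v ≃ ZMod M where
  toFun x := x.1.2
  invFun i := ⟨(v, i), rfl⟩
  left_inv x := by
    obtain ⟨⟨w, i⟩, hw⟩ := x
    change w = v at hw
    subst hw
    rfl
  right_inv _ := rfl

/-- The fibre of the projection over an edge is the set of levels `ℤ/M`.
[cite: MochizukiSemiAnbd2006, Prop. 2.6 p.29] -/
noncomputable def cyclicCoverEdgeFiberEquiv (e : G.Edge) :
    (G.cyclicCoverHom b₀ M).EdgeFiber e ≃ ZMod M where
  toFun x := x.1.2
  invFun i := ⟨(e, i), rfl⟩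
  left_inv x := by
    obtain ⟨⟨f, i⟩, hf⟩ := x
    change f = e at hf
    subst hf
    rfl
  right_inv _ := rfl

/-- For `M ≥ 1` the fibres are finite (of cardinality `M`). [cite: MochizukiSemiAnbd2006, Prop. 2.6 p.29] -/
theorem finite_vertexFiber_cyclicCoverHom [NeZero M] (v : G.Vertex) :
    Finite ((G.cyclicCoverHom b₀ M).VertexFiber v) :=
  Finite.of_equiv _ (G.cyclicCoverVertexFiberEquiv b₀ M v).symm

/-- For `M ≥ 1` the fibres over edges are finite. [cite: MochizukiSemiAnbd2006, Prop. 2.6 p.29] -/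
theorem finite_edgeFiber_cyclicCoverHom [NeZero M] (e : G.Edge) :
    Finite ((G.cyclicCoverHom b₀ M).EdgeFiber e) :=
  Finite.of_equiv _ (G.cyclicCoverEdgeFiberEquiv b₀ M e).symm

/-- The vertex fibres have cardinality `M`. [cite: MochizukiSemiAnbd2006, Prop. 2.6 p.29] -/
theorem card_vertexFiber_cyclicCoverHom [NeZero M] (v : G.Vertex) :
    Nat.card ((G.cyclicCoverHom b₀ M).VertexFiber v) = M := by
  rw [Nat.card_congr (G.cyclicCoverVertexFiberEquiv b₀ M v), Nat.card_zmod]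

/-- **The cyclic cover of a graph is a finite graph-covering** (of degree `M ≥ 1`).
[cite: MochizukiSemiAnbd2006, Prop. 2.6 p.29] -/
theorem cyclicCoverHom_isFiniteGraphCovering [NeZero M] (hG : G.IsGraph) :
    IsFiniteGraphCovering (G.cyclicCoverHom b₀ M) :=
  ⟨⟨(G.cyclicCover_isGraph b₀ M hG).isProper hG _, G.cyclicCoverHom_isExcision b₀ M⟩,
    fun v => G.finite_vertexFiber_cyclicCoverHom b₀ M v,
    fun e => G.finite_edgeFiber_cyclicCoverHom b₀ M e⟩

/-! ### Triviality over a sub-semi-graph avoiding the twisted edge -/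

variable {G b₀}

/-- The level-`i` section over a sub-semi-graph `𝕂` not containing the twisted edge: `v ↦ (v, i)`,
`e ↦ (e, i)`, `b ↦ (b, i)` ("trivial over `𝕂`", p. 29). [cite: MochizukiSemiAnbd2006, Prop. 2.6 p.29] -/
noncomputable def levelSection (K : G.Subgraph) (hK : G.edgeOf b₀ ∉ K.edges) (i : ZMod M) :
    K.toSemiGraph ⟶ G.cyclicCover b₀ M where
  vertexMap v := (v.1, i)
  edgeMap e := (e.1, i)
  branchMap b := (b.1, i)
  edgeOf_branchMap _ := rfl
  branchMap_injOn b₁ b₂ _ h := Subtype.ext (congrArg Prod.fst h)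
  abuts_branchMap b v h := by
    classical
    have hb0 : b.1 ≠ b₀ := by
      rintro hb
      exact hK (hb ▸ b.2)
    -- `b` abuts to `v` in `𝕂`, hence in `G`
    have hG : G.abuts b.1 = some v.1 := by
      change (G.abuts b.1).pbind _ = some v at h
      cases hb : G.abuts b.1 with
      | none => simp [hb] at h
      | some w =>
        simp only [hb, Option.pbind_some] at h
        split_ifs at h with hw
        cases h
        rfl
    change (G.cyclicCover b₀ M).abuts (b.1, i) = some (v.1, i)
    rw [cyclicCover_abuts, hG, Option.map_some, G.levelShift_of_ne b₀ M hb0]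

/-- The level sections lie over the inclusion `𝕂 ↪ 𝔾`. [cite: MochizukiSemiAnbd2006, Prop. 2.6 p.29] -/
theorem levelSection_comp (K : G.Subgraph) (hK : G.edgeOf b₀ ∉ K.edges) (i : ZMod M) :
    levelSection M K hK i ≫ G.cyclicCoverHom b₀ M = K.ι := by
  apply SemiGraph.hom_ext <;> rfl

/-- Every vertex of the cover over a vertex of `𝕂` is hit by exactly one level section (the fibre
over `𝕂` is `𝕂 × ℤ/M`). [cite: MochizukiSemiAnbd2006, Prop. 2.6 p.29] -/
theorem levelSection_vertexMap_surjective (K : G.Subgraph) (hK : G.edgeOf b₀ ∉ K.edges)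
    (x : (G.cyclicCover b₀ M).Vertex) (hx : x.1 ∈ K.verts) :
    ∃! i : ZMod M, (levelSection M K hK i).vertexMap ⟨x.1, hx⟩ = x :=
  ⟨x.2, rfl, fun _ hj => (congrArg Prod.snd hj : _)⟩

end SemiGraph

end Literature.AnabelianGeometry.SemiGraphs
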